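import Mathlib
import HarnessLib

/-!
# Integration formulas of open type: Steffensen's formulas (Davis–Rabinowitz 1984, Sect. 2.6)

Davis–Rabinowitz, *Methods of Numerical Integration* (2nd ed., 1984), Sect. 2.6 "Integration Formulas of Open
Type", p. 92: the open Newton–Cotes ("Steffensen") formulas — the two-point formula
`3h/2 [f(a+h) + f(a+2h)] + (3/4) h³ f''(ξ)`, `h = (b-a)/3` (2.6.2); the three-point formula (Milne's rule)
`4h/3 [2f(a+h) - f(a+2h) + 2f(a+3h)] + (14/45) h⁵ f⁽⁴⁾(ξ)`, `h = (b-a)/4` (2.6.3); the four-point formula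
`5h/24 [11f(a+h) + f(a+2h) + f(a+3h) + 11f(a+4h)] + (95/144) h⁵ f⁽⁴⁾(ξ)`, `h = (b-a)/5` (2.6.4).

Recorded (self-contained, by coefficientwise expansion of polynomials): the three rules, their polynomial
exactness (degrees `≤ 1`, `≤ 3`, `≤ 3`), and the error constants of (2.6.2)–(2.6.4) *pinned on the first
non-exact degree* (`∫ p - R p = (3/4) h³ · 2c₂`, `(14/45) h⁵ · 24c₄`, `(95/144) h⁵ · 24c₄`), with the unit-interval
values `1/18`, `7/960`, `19/3750`.  The `ξ`-forms for `f ∈ C²`, `C⁴` follow from Peano's theorem and are not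
restated; the midpoint formula (2.6.5) is the tree's `MidpointTrapezoidPeanoKernel`.

Provenance: engines group, shared numerical engines serving client cells; rigour lives in the verifiers; every
published number belongs to a client cell's ledger, not to the engines group.  Textbook facts only (no client
numbers).
-/

namespace Literature.Analysis.Quadrature

open Set MeasureTheory intervalIntegral Finset Polynomial
open scoped Real Interval

noncomputable section

/-- [folklore] `∫_a^b p = Σ_{i<n} c_i (b^{i+1} - a^{i+1})/(i+1)` for `deg p < n`. -/
private theorem integral_eval_eq_sum' (p : ℝ[X]) {n : ℕ} (hn : p.natDegree < n) (a b : ℝ) :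
    ∫ x in a..b, p.eval x = ∑ i ∈ range n, p.coeff i * ((b ^ (i + 1) - a ^ (i + 1)) / (i + 1)) := by
  simp_rw [eval_eq_sum_range' hn]
  rw [intervalIntegral.integral_finsetSum fun i _ => ?_]
  · refine Finset.sum_congr rfl fun i _ => ?_
    rw [intervalIntegral.integral_const_mul, integral_pow]
  · exact (continuous_const.mul (continuous_pow i)).intervalIntegrable _ _

/-! ### Steffensen's open formulas (2.6.2)–(2.6.4) -/

/-- The open two-point formula `3h/2 [f(a+h) + f(a+2h)]`, `h = (b - a)/3`.
[cite: DavisRabinowitz1984, Sect. 2.6 (2.6.2)] -/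
def openTwoPoint (f : ℝ → ℝ) (a b : ℝ) : ℝ :=
  (b - a) / 2 * (f (a + (b - a) / 3) + f (a + 2 * (b - a) / 3))

/-- The open three-point formula (Milne's rule) `4h/3 [2f(a+h) - f(a+2h) + 2f(a+3h)]`, `h = (b - a)/4`.
[cite: DavisRabinowitz1984, Sect. 2.6 (2.6.3)] -/
def openThreePoint (f : ℝ → ℝ) (a b : ℝ) : ℝ :=
  (b - a) / 3 * (2 * f (a + (b - a) / 4) - f (a + (b - a) / 2) + 2 * f (a + 3 * (b - a) / 4))

/-- The open four-point formula `5h/24 [11f(a+h) + f(a+2h) + f(a+3h) + 11f(a+4h)]`, `h = (b - a)/5`.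
[cite: DavisRabinowitz1984, Sect. 2.6 (2.6.4)] -/
def openFourPoint (f : ℝ → ℝ) (a b : ℝ) : ℝ :=
  (b - a) / 24 *
    (11 * f (a + (b - a) / 5) + f (a + 2 * (b - a) / 5) + f (a + 3 * (b - a) / 5) + 11 * f (a + 4 * (b - a) / 5))

/-- (2.6.2): the two-point formula is exact for linear polynomials. [cite: DavisRabinowitz1984, Sect. 2.6 (2.6.2)] -/
theorem integral_eq_openTwoPoint_of_natDegree_le (p : ℝ[X]) (hp : p.natDegree ≤ 1) (a b : ℝ) :
    ∫ x in a..b, p.eval x = openTwoPoint (fun x => p.eval x) a b := by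
  have hn : p.natDegree < 2 := by omega
  rw [integral_eval_eq_sum' p hn, openTwoPoint]
  simp only [eval_eq_sum_range' hn, Finset.sum_range_succ, Finset.sum_range_zero]
  push_cast
  ring

/-- (2.6.2), error `+ (3/4) h³ f''(ξ)` pinned on quadratics (`f'' ≡ 2 c₂`):
`∫_a^b p - R(p) = (3/4) h³ · 2 c₂`, `h = (b - a)/3`. [cite: DavisRabinowitz1984, Sect. 2.6 (2.6.2)] -/
theorem integral_sub_openTwoPoint_of_natDegree_le_two (p : ℝ[X]) (hp : p.natDegree ≤ 2) (a b : ℝ) :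
    (∫ x in a..b, p.eval x) - openTwoPoint (fun x => p.eval x) a b = 3 / 4 * ((b - a) / 3) ^ 3 * (2 * p.coeff 2) := by
  have hn : p.natDegree < 3 := by omega
  rw [integral_eval_eq_sum' p hn, openTwoPoint]
  simp only [eval_eq_sum_range' hn, Finset.sum_range_succ, Finset.sum_range_zero]
  push_cast
  ring

/-- (2.6.3): Milne's rule is exact for cubics. [cite: DavisRabinowitz1984, Sect. 2.6 (2.6.3)] -/
theorem integral_eq_openThreePoint_of_natDegree_le (p : ℝ[X]) (hp : p.natDegree ≤ 3) (a b : ℝ) :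
    ∫ x in a..b, p.eval x = openThreePoint (fun x => p.eval x) a b := by
  have hn : p.natDegree < 4 := by omega
  rw [integral_eval_eq_sum' p hn, openThreePoint]
  simp only [eval_eq_sum_range' hn, Finset.sum_range_succ, Finset.sum_range_zero]
  push_cast
  ring

/-- (2.6.3), error `+ (14/45) h⁵ f⁽⁴⁾(ξ)` pinned on quartics (`f⁽⁴⁾ ≡ 24 c₄`), `h = (b - a)/4`.
[cite: DavisRabinowitz1984, Sect. 2.6 (2.6.3)] -/
theorem integral_sub_openThreePoint_of_natDegree_le_four (p : ℝ[X]) (hp : p.natDegree ≤ 4) (a b : ℝ) :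
    (∫ x in a..b, p.eval x) - openThreePoint (fun x => p.eval x) a b =
      14 / 45 * ((b - a) / 4) ^ 5 * (24 * p.coeff 4) := by
  have hn : p.natDegree < 5 := by omega
  rw [integral_eval_eq_sum' p hn, openThreePoint]
  simp only [eval_eq_sum_range' hn, Finset.sum_range_succ, Finset.sum_range_zero]
  push_cast
  ring

/-- (2.6.4): the four-point formula is exact for cubics. [cite: DavisRabinowitz1984, Sect. 2.6 (2.6.4)] -/
theorem integral_eq_openFourPoint_of_natDegree_le (p : ℝ[X]) (hp : p.natDegree ≤ 3) (a b : ℝ) :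
    ∫ x in a..b, p.eval x = openFourPoint (fun x => p.eval x) a b := by
  have hn : p.natDegree < 4 := by omega
  rw [integral_eval_eq_sum' p hn, openFourPoint]
  simp only [eval_eq_sum_range' hn, Finset.sum_range_succ, Finset.sum_range_zero]
  push_cast
  ring

/-- (2.6.4), error `+ (95/144) h⁵ f⁽⁴⁾(ξ)` pinned on quartics (`f⁽⁴⁾ ≡ 24 c₄`), `h = (b - a)/5`.
[cite: DavisRabinowitz1984, Sect. 2.6 (2.6.4)] -/
theorem integral_sub_openFourPoint_of_natDegree_le_four (p : ℝ[X]) (hp : p.natDegree ≤ 4) (a b : ℝ) :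
    (∫ x in a..b, p.eval x) - openFourPoint (fun x => p.eval x) a b =
      95 / 144 * ((b - a) / 5) ^ 5 * (24 * p.coeff 4) := by
  have hn : p.natDegree < 5 := by omega
  rw [integral_eval_eq_sum' p hn, openFourPoint]
  simp only [eval_eq_sum_range' hn, Finset.sum_range_succ, Finset.sum_range_zero]
  push_cast
  ring

/-- The three error constants on `[0, 1]`: `x²` by the two-point formula misses by `1/18`, `x⁴` by Milne's rule
by `7/960`, `x⁴` by the four-point formula by `19/3750` — all *positive* in the book's convention `∫ = R + E`
(the open formulas underestimate the integrals of these monomials).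
[cite: DavisRabinowitz1984, Sect. 2.6 (2.6.2)-(2.6.4)] -/
theorem open_error_constants_unit_interval :
    (∫ x in (0 : ℝ)..1, (X ^ 2 : ℝ[X]).eval x) - openTwoPoint (fun x => (X ^ 2 : ℝ[X]).eval x) 0 1 = 1 / 18 ∧
    (∫ x in (0 : ℝ)..1, (X ^ 4 : ℝ[X]).eval x) - openThreePoint (fun x => (X ^ 4 : ℝ[X]).eval x) 0 1 = 7 / 960 ∧
    (∫ x in (0 : ℝ)..1, (X ^ 4 : ℝ[X]).eval x) - openFourPoint (fun x => (X ^ 4 : ℝ[X]).eval x) 0 1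
      = 19 / 3750 := by
  refine ⟨?_, ?_, ?_⟩
  · rw [integral_sub_openTwoPoint_of_natDegree_le_two _ (by simp)]
    simp
    norm_num
  · rw [integral_sub_openThreePoint_of_natDegree_le_four _ (by simp)]
    simp
    norm_num
  · rw [integral_sub_openFourPoint_of_natDegree_le_four _ (by simp)]
    simp
    norm_num

end

end Literature.Analysis.Quadrature
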